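import Summits.ResolutionOfSingularities.ResolutionOfSingularities.Theorems.WildConesCampaignW46HypersurfacesCharTwoEmbDimDefs
import Summits.ResolutionOfSingularities.ResolutionOfSingularities.Theorems.WildConesCampaignW46HypersurfacesCharTwoCubicFormDefs
import Summits.ResolutionOfSingularities.ResolutionOfSingularities.Theorems.WildConesCampaignW46HypersurfacesCharTwoHilbertDefs
import Mathlib.Algebra.CharP.Defs
import Mathlib.FieldTheory.Perfect
import Mathlib.Data.Matrix.Mul

/-!
# [OURS · L1 W4.6, rung (ii)] STATEMENTS of the near-locus package — THE EXACT LOCUS OF THE INFINITELY-NEAR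
# `p`-FOLD POINTS of a hypersurface `p`-fold point `z^p = a(u₁,…,uₙ)` IN EVERY DIMENSION `n` AND EVERY CORANK
# (instance `p = 2` proved for all `n`) over route WildCones' point-blow-up dynamics — campaign s46 of cell
# res-hironaka (LADDER-RESOLUTION rung L, D-0089); host route WildCones,
# `--kind definition --supports stmt-ResolutionOfSingularities-16884`

HONEST FRAMING. Everything below is OURS (campaign statements of slot W4.6, typed by the prover res-L1-s46-pv-4
(gen 5) in the pattern of `Theorems/WildConesCampaignW46HypersurfacesCharTwoEmbDimStatement.lean` (p519225, OURS-desk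
#199, lanes A/B 21/21; that file is at the 400-line cap, hence this new file): predicates `def … (p n : ℕ) : Prop` in
the characteristic AND THE DIMENSION, one decl per statement, no theorem, no `sorry`) over route WildCones' typed
point-blow-up dynamics (`Theorems/WildConesClassicalRegimesDefs.lean`: states `c : (Fin n → ℕ) → κ` = coefficients of
`a(u₁,…,uₙ)` in `z^p = a`, `ser` the cleaned series, `step i τ c` = blow up the point, chart `u_i`, translate by `τ`,
delete `p`-th powers; `MultP` = cleaned order `≥ p`, `OrdP` = a cleaned monomial of degree `p`, `Isol` = finite Milnor
algebra `κ⟦u⟧/(∂a)`, `mu` = its dimension), the seat's invariant `CampaignW46.milnorEmbDim p n κ c = e(c)` (p498937;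
at `p = 2` the corank of the POLAR MATRIX `P = ([u_s u_t] a)_{s ≠ t}` of the cleaned quadratic part, spelled out below
as in p506168's `CampaignW46HypersurfacesEmbDimPolarCorank`) and the seat's gen-5 definition `CampaignW46.degForm`
(p522667: `degForm 3 (ser c) w = a₃(w) = Σ_{|A|=3} [u^A]a · w^A`, the TANGENT CUBIC at `w`). The NEAR VECTOR of a chart
`i` and a translation `τ` is `w = (τ with w_i = 1)` (`Function.update τ i 1`): the homogeneous coordinates of the
visited point of the exceptional divisor `ℙ^{n−1}`. They are NOT statements of H. Hironaka's manuscript [Hironaka2017]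
and use nothing from it; each docstring says which printed item's ROLE the statement replaces (Th. 16.6 p.84: the
next centre `D′ = ∇′ ∩ π⁻¹(D)`; §16.3 / Th. 16.13 p.87), under adjudication, never as fact. No FACT-LIST premise
occurs. AI bookkeeping, weaker than expert review.

WHAT THE PACKAGE SAYS (proved at `p = 2` for every `n` in this seat's gen-5 files
`…HypersurfacesCharTwo{CubicForm,BlowupInjective,NearLocus,NearCount}.lean`, p523523 / p524364 / p524988 / the
NearCount file; closers by name in `…HypersurfacesCharTwoNearLocusProof.lean`): the linear part of the strict transform
at `(i, τ)` is `(w·P)` off the chart variable and `a₃(w)` at it, so — for an ISOLATED `p`-fold state, whose cleaned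
successors are never zero — A `p`-FOLD SUCCESSOR SITS AT `(i, τ)` IFF `w·P = 0 ∧ a₃(w) = 0`: the infinitely-near `p`-fold
points are the points of the projective kernel `ℙ(ker P) ≅ ℙ^{e−1}` on the cubic `a₃ = 0` (every corank `e`). In corank
one the near point exists iff `a₃` vanishes at the kernel point, equivalently (`n ≥ 3`) iff `μ ≥ 4`; in corank two there
are at most THREE near points unless `a₃` vanishes on the kernel plane, in which case the whole kernel line consists
of near points.

REV 2 (same seat, gen 5, 2026-08-27, APPEND-ONLY: the nine rev-1 predicates are byte-identical; one import added —
`…HypersurfacesCharTwoHilbertDefs.lean`, p511581, for `CampaignW46.milnorHilbertTwo p n κ c = h₂(c)`; five predicates appended):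
THE LINK WITH gen 4's INVARIANT `h₂` AT CORANK TWO. `CampaignW46HypersurfacesHilbertThreeCubic` (`e = 2`, `h₂ = 3` ⇒ the
tangent cubic vanishes at every kernel vector), `CampaignW46HypersurfacesHilbertThreeIffPolar` (`e = 2`: `h₂ = 3` IFF all polars
`Σₛ λₛ (∂ₛa)₂(v)`, `λ, v ∈ ker P`, vanish — the cubic restricted to the kernel plane is the zero FORM),
`CampaignW46HypersurfacesHilbertThreeWholeKernel` (isolated, `e = 2`, `h₂ = 3` ⇒ every non-zero kernel vector is an
infinitely-near `p`-fold point whose successor is NON-isolated), `CampaignW46HypersurfacesCubicOffKernelHilbert` (`e = 2`, a kernel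
vector with `a₃ ≠ 0` ⇒ `h₂ ≤ 2`) and `CampaignW46HypersurfacesCubicOffKernelIsolated` (isolated, `e = 2`, a kernel vector with
`a₃ ≠ 0` ⇒ at most three infinitely-near `p`-fold points AND every `p`-fold successor isolated with smaller `μ`). Their `p = 2`
instances are PROVED for every `n` in `…HypersurfacesCharTwo{DegFormCalculus,SixClasses,TangentCubicKernel,HilbertThreeIff}.lean`
(p528427, p529758, p530584, the HilbertThreeIff file: the six classes `1, x, y, x², xy, y²` span `κ⟦u⟧/((∂a)+𝔪³)`, of dimension
`h₂ + 3`, and are independent iff the polars vanish on the kernel); closers by name appended to `…NearLocusProof.lean`.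

REV 3 (same seat, gen 5, APPEND-ONLY: the fourteen rev-1/rev-2 predicates are byte-identical; three predicates appended): THE SUCCESSOR'S
CORANK AT A NEAR POINT OF A CORANK-TWO STATE, read off the 3-jet. `CampaignW46HypersurfacesSuccessorCorankTwoIff` (`e(c) = 2`, `p`-fold
successor at `(i, τ)`: `e(successor) = 2` IFF all polars of the tangent cubic at the near vector `w` vanish on the kernel — `w` a SINGULAR
point of the kernel cubic, a «satellite» direction; otherwise `e(successor) = 0`), `CampaignW46HypersurfacesFreePointResolved` (some kernel
polar at `w` non-zero ⇒ the successor is isolated with `μ = 1` and no `p`-fold point follows it) and `CampaignW46HypersurfacesSatelliteNear`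
(isolated, `e = 2`: a singular direction `λ` of the kernel cubic IS a near `p`-fold point and its successor has `e = 2`). Their `p = 2`
instances are PROVED for every `n` in `…HypersurfacesCharTwoSuccessorCorank.lean` (p533887: the successor's polar matrix is the old one with
row and column `i` replaced by the gradient of the tangent cubic at `w`); closers appended to `…NearLocusProof.lean`.

REV 4 (same seat, gen 5, APPEND-ONLY: the seventeen rev-1/2/3 predicates are byte-identical; one import added — `Mathlib.FieldTheory.Perfect`;
four predicates appended): HOW MANY SATELLITES. `CampaignW46HypersurfacesSatelliteUnique` (`e = 2`, `h₂ ≤ 2` ⇒ the singular directions of the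
kernel cubic are pairwise proportional: AT MOST ONE satellite near point), `CampaignW46HypersurfacesNoSatelliteHilbertOne` (isolated, `e = 2`,
`h₂ = 1` ⇒ no non-zero singular direction: all near points free), `CampaignW46HypersurfacesSatelliteExistsHilbertTwo` (PERFECT field, `e = 2`,
`h₂ = 2` ⇒ a non-zero singular direction EXISTS) and `CampaignW46HypersurfacesSatelliteStepHilbertTwo` (perfect field, isolated, `e = 2`, `h₂ = 2`
⇒ some chart/translation gives a corank-two ISOLATED `p`-fold successor with smaller `μ`). Their `p = 2` instances are PROVED for every `n` in
`…HypersurfacesCharTwo{SatelliteUnique,SatelliteExists}.lean` (p536239: polarization identity and `D_wD_w a = 0` in characteristic two; the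
SatelliteExists file: a null polar exists when `h₂ ≥ 2`, additive polars have square-root zeros over a perfect field); closers appended to
`…NearLocusProof.lean`.

REV 5 (same seat, gen 5, APPEND-ONLY: the twenty-one rev-1/2/3/4 predicates are byte-identical; two predicates appended): PAIR-FREE `p`-fold
points (`¬OrdP`, `e = n` — for threefolds the only corank besides `e = 1`). `CampaignW46HypersurfacesPairFreeNearCubic` (isolated, `¬OrdP`: `p`-fold
successor at `(i, τ)` iff the tangent cubic vanishes at the near vector — the near points are the cubic hypersurface `{a₃ = 0} ⊂ ℙ^{n−1}`) and
`CampaignW46ThreefoldsNearDichotomy` (isolated threefold `p`-fold point: order-`p`-cleaned with `e = 1`, or pair-free with a plane cubic of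
NON-isolated near `p`-fold points). Their `p = 2` instances are PROVED in `…HypersurfacesCharTwoPairFreeCubic.lean` (p540046); closers appended
to `…NearLocusProof.lean`.

## References

* [GreuelPfister2026] G.-M. Greuel, G. Pfister, The splitting lemma in any characteristic, J. Algebra 689 (2026)
  = arXiv:2507.17078, Thm 3.5 and Cor 3.7 (hyperbolic pairs in characteristic two: context of `e`, `P`).
* [CasasAlvero2000] E. Casas-Alvero, Singularities of Plane Curves, LMS LN 276 (2000), §3 (infinitely near points
  and the tangent cone: context).
* [Hironaka2017] H. Hironaka, ms. 2017-03-23, Th. 16.6 p.84, §16.3 / Th. 16.13 p.87 — ROLE replaced only.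
-/

noncomputable section

set_option linter.dupNamespace false -- mandated namespace of this single-conjunct summit

open scoped Classical

namespace Summit.ResolutionOfSingularities.ResolutionOfSingularities.Theorems

/-- [OURS · L1 W4.6 rung (ii), every dimension; near-locus rev 1] replaces the role of the DESCRIPTION of the
next centre (Th. 16.6 p.84 L5–L6, `D′ = ∇′ ∩ π⁻¹(D)`) by ONE EQUATION, for hypersurface `p`-fold points of route
WildCones' dynamics; NOT a statement of the manuscript. For every field `κ` of characteristic `p`, every `p`-fold
state `c` of `z^p = a(u₁,…,uₙ)`, every chart `i` and translation `τ` whose successor is a `p`-fold point: the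
TANGENT CUBIC of the cleaned state vanishes at the near vector, `degForm 3 (ser c) (τ with i ↦ 1) = 0`. Instance
`p = 2` PROVED for every `n` by `CampaignW46.HypersurfacesCharTwo.hypersurface_cubic_eq_zero_of_double_successor`
(it is the `u_i`-coefficient of the strict transform, p523523); other `p` not claimed. [folklore] -/
def CampaignW46HypersurfacesNearCubic (p n : ℕ) : Prop :=
  ∀ (κ : Type) [Field κ] [CharP κ p] (c : (Fin n → ℕ) → κ) (i : Fin n) (τ : Fin n → κ),
    WildCones.MultP p n κ c → WildCones.MultP p n κ (WildCones.step p n κ i τ c) →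
      CampaignW46.degForm 3 (WildCones.ser p n κ c) (Function.update τ i 1) = 0

/-- [OURS · L1 W4.6 rung (ii), every dimension; near-locus rev 1] replaces the role of NOTHING printed (a
structural fact of OUR dynamics: leaving multiplicity `p` means a smooth point, never the zero state); NOT a
statement of the manuscript. For every field `κ` of characteristic `p`, every ISOLATED `p`-fold state `c` of
`z^p = a(u₁,…,uₙ)`, every chart `i` and translation `τ`: the cleaned successor `ser (step i τ c)` is NON-ZERO.
Instance `p = 2` PROVED for every `n` by `CampaignW46.HypersurfacesCharTwo.hypersurface_ser_step_ne_zero` (the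
blow-up substitution is injective on `κ⟦u⟧`, p524364); other `p` not claimed. [folklore] -/
def CampaignW46HypersurfacesNonzeroSuccessor (p n : ℕ) : Prop :=
  ∀ (κ : Type) [Field κ] [CharP κ p] (c : (Fin n → ℕ) → κ) (i : Fin n) (τ : Fin n → κ),
    WildCones.MultP p n κ c → WildCones.Isol p n κ c → WildCones.ser p n κ (WildCones.step p n κ i τ c) ≠ 0

/-- [OURS · L1 W4.6 rung (ii), every dimension, EVERY CORANK; near-locus rev 1] replaces the role of the
DESCRIPTION of the next centre (Th. 16.6 p.84 L5–L6, `D′ = ∇′ ∩ π⁻¹(D)`) for ISOLATED hypersurface `p`-fold points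
of route WildCones' dynamics, EXACTLY; NOT a statement of the manuscript. THE NEAR-POINT CRITERION: for every field
`κ` of characteristic `p`, every isolated `p`-fold state `c` of `z^p = a(u₁,…,uₙ)`, every chart `i` and translation
`τ`, with near vector `w = (τ with i ↦ 1)` and polar matrix `P = ([u_s u_t] a)_{s≠t}` of the cleaned series: the
successor `step i τ c` is a `p`-fold point IFF `w·P = 0` AND `degForm 3 (ser c) w = 0` — the infinitely-near `p`-fold
points are the points of the projective kernel of `P` on the tangent cubic. Instance `p = 2` PROVED for every `n` by
`CampaignW46.HypersurfacesCharTwo.hypersurface_multP_step_iff` (p524988); other `p` not claimed.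
[cite: GreuelPfister2026, Thm 3.5 and Cor 3.7] -/
def CampaignW46HypersurfacesNearCriterion (p n : ℕ) : Prop :=
  ∀ (κ : Type) [Field κ] [CharP κ p] (c : (Fin n → ℕ) → κ) (i : Fin n) (τ : Fin n → κ),
    WildCones.MultP p n κ c → WildCones.Isol p n κ c →
      (WildCones.MultP p n κ (WildCones.step p n κ i τ c) ↔
        Matrix.vecMul (Function.update τ i 1)
            (Matrix.of fun s t : Fin n => if s = t then (0 : κ)
              else MvPowerSeries.coeff (Finsupp.single s 1 + Finsupp.single t 1) (WildCones.ser p n κ c)) = 0 ∧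
          CampaignW46.degForm 3 (WildCones.ser p n κ c) (Function.update τ i 1) = 0)

/-- [OURS · L1 W4.6 rung (ii), every dimension; near-locus rev 1] the same criterion for ORDER-`p`-CLEANED
states (`OrdP`: a cleaned monomial of degree `p`) WITHOUT isolatedness; NOT a statement of the manuscript. For every
field `κ` of characteristic `p`, every `p`-fold state `c` with `OrdP c`, every chart `i` and translation `τ`:
`MultP (step i τ c) ↔ w·P = 0 ∧ degForm 3 (ser c) w = 0`. Instance `p = 2` PROVED for every `n` by
`CampaignW46.HypersurfacesCharTwo.hypersurface_multP_step_iff_of_ordP` (p524988); other `p` not claimed.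
[folklore] -/
def CampaignW46HypersurfacesNearCriterionOrdP (p n : ℕ) : Prop :=
  ∀ (κ : Type) [Field κ] [CharP κ p] (c : (Fin n → ℕ) → κ) (i : Fin n) (τ : Fin n → κ),
    WildCones.MultP p n κ c → WildCones.OrdP p n κ c →
      (WildCones.MultP p n κ (WildCones.step p n κ i τ c) ↔
        Matrix.vecMul (Function.update τ i 1)
            (Matrix.of fun s t : Fin n => if s = t then (0 : κ)
              else MvPowerSeries.coeff (Finsupp.single s 1 + Finsupp.single t 1) (WildCones.ser p n κ c)) = 0 ∧
          CampaignW46.degForm 3 (WildCones.ser p n κ c) (Function.update τ i 1) = 0)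

/-- [OURS · L1 W4.6 rung (ii), every dimension; near-locus rev 1] replaces the role of the WELL-DEFINEDNESS of the
next centre as a subset of the exceptional divisor (Th. 16.6 p.84 L5–L6) — independence of the chart — for isolated
hypersurface `p`-fold points; NOT a statement of the manuscript. For every field `κ` of characteristic `p`, every
isolated `p`-fold state `c`, charts `i, i'` and translation `τ` with a `p`-fold successor at `(i, τ)` whose near vector
`w = (τ with i ↦ 1)` has `w_{i'} ≠ 0`: chart `i'` at the translation `w / w_{i'}` also has a `p`-fold successor (the
same point of `ℙ^{n−1}`). Instance `p = 2` PROVED for every `n` by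
`CampaignW46.HypersurfacesCharTwo.hypersurface_multP_step_rescale` (p524988); other `p` not claimed. [folklore] -/
def CampaignW46HypersurfacesNearProjective (p n : ℕ) : Prop :=
  ∀ (κ : Type) [Field κ] [CharP κ p] (c : (Fin n → ℕ) → κ) (i i' : Fin n) (τ : Fin n → κ),
    WildCones.MultP p n κ c → WildCones.Isol p n κ c → WildCones.MultP p n κ (WildCones.step p n κ i τ c) →
      Function.update τ i 1 i' ≠ 0 →
        WildCones.MultP p n κ
          (WildCones.step p n κ i' ((Function.update τ i 1 i')⁻¹ • Function.update τ i 1) c)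

/-- [OURS · L1 W4.6 rung (ii), every dimension; near-locus rev 1] replaces the role of the EXISTENCE question
for the next centre (Th. 16.6 p.84 L4–L6) in corank one, by ONE EVALUATION; NOT a statement of the manuscript. For
every field `κ` of characteristic `p`, every isolated `p`-fold state `c` with `e(c) = 1` and every non-zero kernel
vector `w₀` of the polar matrix (`w₀·P = 0`; the kernel is the line `κ w₀`): SOME chart and translation give a
`p`-fold successor IFF `degForm 3 (ser c) w₀ = 0`. Instance `p = 2` PROVED for every `n` by
`CampaignW46.HypersurfacesCharTwo.hypersurface_exists_double_successor_iff_cubic` (p524988); other `p` not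
claimed. [folklore] -/
def CampaignW46HypersurfacesCorankOneCubic (p n : ℕ) : Prop :=
  ∀ (κ : Type) [Field κ] [CharP κ p] (c : (Fin n → ℕ) → κ) (w₀ : Fin n → κ),
    WildCones.MultP p n κ c → WildCones.Isol p n κ c → CampaignW46.milnorEmbDim p n κ c = 1 → w₀ ≠ 0 →
      Matrix.vecMul w₀ (Matrix.of fun s t : Fin n => if s = t then (0 : κ)
        else MvPowerSeries.coeff (Finsupp.single s 1 + Finsupp.single t 1) (WildCones.ser p n κ c)) = 0 →
        ((∃ (i : Fin n) (τ : Fin n → κ), WildCones.MultP p n κ (WildCones.step p n κ i τ c)) ↔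
          CampaignW46.degForm 3 (WildCones.ser p n κ c) w₀ = 0)

/-- [OURS · L1 W4.6 rung (ii), every dimension `n ≥ 3`; near-locus rev 1] replaces the role of NOTHING printed
(an explicit 3-jet test for OUR numbers: «resolved by one blow-up»); NOT a statement of the manuscript. For every
field `κ` of characteristic `p`, `n ≥ 3`, every isolated `p`-fold state `c` with `e(c) = 1` and non-zero kernel vector
`w₀` of the polar matrix: `μ(c) = 2` IFF the tangent cubic does NOT vanish at the kernel point,
`degForm 3 (ser c) w₀ ≠ 0`. Instance `p = 2` PROVED for every `n ≥ 3` by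
`CampaignW46.HypersurfacesCharTwo.hypersurface_mu_eq_two_iff_cubic_ne_zero` (p524988, with gen 3's
`…_iff_four_le_mu`); other `p` not claimed. [cite: GreuelPfister2026, Thm 3.5 and Cor 3.7] -/
def CampaignW46HypersurfacesMuTwoCubic (p n : ℕ) : Prop :=
  3 ≤ n → ∀ (κ : Type) [Field κ] [CharP κ p] (c : (Fin n → ℕ) → κ) (w₀ : Fin n → κ),
    WildCones.MultP p n κ c → WildCones.Isol p n κ c → CampaignW46.milnorEmbDim p n κ c = 1 → w₀ ≠ 0 →
      Matrix.vecMul w₀ (Matrix.of fun s t : Fin n => if s = t then (0 : κ)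
        else MvPowerSeries.coeff (Finsupp.single s 1 + Finsupp.single t 1) (WildCones.ser p n κ c)) = 0 →
        (WildCones.mu p n κ c = 2 ↔ CampaignW46.degForm 3 (WildCones.ser p n κ c) w₀ ≠ 0)

/-- [OURS · L1 W4.6 rung (ii), every dimension, every corank; near-locus rev 1] replaces the role of NOTHING
printed (the case of a POSITIVE-DIMENSIONAL candidate locus on the exceptional divisor, for OUR dynamics); NOT a
statement of the manuscript. For every field `κ` of characteristic `p` and every isolated `p`-fold state `c`: EVERY
non-zero kernel vector `w` of the polar matrix, read in the chart `i` of any non-zero coordinate `w_i` at the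
translation `w / w_i`, gives a `p`-fold successor — IFF the tangent cubic `degForm 3 (ser c)` vanishes at every kernel
vector. Instance `p = 2` PROVED for every `n` by
`CampaignW46.HypersurfacesCharTwo.hypersurface_nearPoints_whole_kernel_iff` (NearCount file); other `p` not claimed.
[folklore] -/
def CampaignW46HypersurfacesNearWholeKernel (p n : ℕ) : Prop :=
  ∀ (κ : Type) [Field κ] [CharP κ p] (c : (Fin n → ℕ) → κ),
    WildCones.MultP p n κ c → WildCones.Isol p n κ c →
      ((∀ (w : Fin n → κ) (i : Fin n),
          Matrix.vecMul w (Matrix.of fun s t : Fin n => if s = t then (0 : κ)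
            else MvPowerSeries.coeff (Finsupp.single s 1 + Finsupp.single t 1) (WildCones.ser p n κ c)) = 0 →
          w i ≠ 0 → WildCones.MultP p n κ (WildCones.step p n κ i ((w i)⁻¹ • w) c)) ↔
        ∀ w : Fin n → κ,
          Matrix.vecMul w (Matrix.of fun s t : Fin n => if s = t then (0 : κ)
            else MvPowerSeries.coeff (Finsupp.single s 1 + Finsupp.single t 1) (WildCones.ser p n κ c)) = 0 →
          CampaignW46.degForm 3 (WildCones.ser p n κ c) w = 0)

/-- [OURS · L1 W4.6 rung (ii), every dimension; near-locus rev 1] replaces the role of the FINITENESS and the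
explicit description of the candidate centres after one blow-up (Th. 16.6 p.84 L4–L6) for ISOLATED CORANK-TWO
hypersurface `p`-fold points, WITH A NUMBER; NOT a statement of the manuscript. For every field `κ` of
characteristic `p` and every isolated `p`-fold state `c` with `e(c) = 2` whose tangent cubic does not vanish at some
kernel vector of the polar matrix: there is a finite set `S` of AT MOST THREE vectors such that the near vector
`(τ with i ↦ 1)` of every `p`-fold successor `(i, τ)` is a multiple of a member of `S` — at most three
infinitely-near `p`-fold points, on the kernel line of `ℙ^{n−1}`. Instance `p = 2` PROVED for every `n` by
`CampaignW46.HypersurfacesCharTwo.hypersurface_nearPoints_le_three` (NearCount file: roots of the binary cubic);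
other `p` not claimed. [cite: CasasAlvero2000, §3] -/
def CampaignW46HypersurfacesCorankTwoCount (p n : ℕ) : Prop :=
  ∀ (κ : Type) [Field κ] [CharP κ p] (c : (Fin n → ℕ) → κ),
    WildCones.MultP p n κ c → WildCones.Isol p n κ c → CampaignW46.milnorEmbDim p n κ c = 2 →
      (∃ v : Fin n → κ,
        Matrix.vecMul v (Matrix.of fun s t : Fin n => if s = t then (0 : κ)
          else MvPowerSeries.coeff (Finsupp.single s 1 + Finsupp.single t 1) (WildCones.ser p n κ c)) = 0 ∧
        CampaignW46.degForm 3 (WildCones.ser p n κ c) v ≠ 0) →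
      ∃ S : Finset (Fin n → κ), S.card ≤ 3 ∧
        ∀ (i : Fin n) (τ : Fin n → κ), WildCones.MultP p n κ (WildCones.step p n κ i τ c) →
          ∃ w ∈ S, ∃ r : κ, Function.update τ i 1 = r • w


/-- [OURS · L1 W4.6 rung (ii), every dimension; near-locus rev 2] replaces the role of NOTHING printed (it identifies the
«no tangent cubic» class of OUR invariants, `(e, h₂) = (2, 3)`, through which alone the forced regime is left sideways, rev 5 of
the EmbDim statements, BY THE 3-JET); NOT a statement of the manuscript. For every field `κ` of characteristic `p` and every
`p`-fold state `c` of `z^p = a(u₁,…,uₙ)` with `e(c) = 2` and `h₂(c) = 3`: the tangent cubic vanishes at every kernel vector `w` of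
the polar matrix, `degForm 3 (ser c) w = 0`. Instance `p = 2` PROVED for every `n` by
`CampaignW46.HypersurfacesCharTwo.hypersurface_cubic_eq_zero_of_milnorHilbertTwo_eq_three` (p530584); other `p` not claimed.
[folklore] -/
def CampaignW46HypersurfacesHilbertThreeCubic (p n : ℕ) : Prop :=
  ∀ (κ : Type) [Field κ] [CharP κ p] (c : (Fin n → ℕ) → κ) (w : Fin n → κ),
    WildCones.MultP p n κ c → CampaignW46.milnorEmbDim p n κ c = 2 → CampaignW46.milnorHilbertTwo p n κ c = 3 →
      Matrix.vecMul w (Matrix.of fun s t : Fin n => if s = t then (0 : κ)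
        else MvPowerSeries.coeff (Finsupp.single s 1 + Finsupp.single t 1) (WildCones.ser p n κ c)) = 0 →
        CampaignW46.degForm 3 (WildCones.ser p n κ c) w = 0

/-- [OURS · L1 W4.6 rung (ii), every dimension; near-locus rev 2] replaces the role of NOTHING printed (a complete description of
OUR invariant `h₂` at corank two by the 3-jet); NOT a statement of the manuscript. For every field `κ` of characteristic `p` and
every `p`-fold state `c` with `e(c) = 2`: `h₂(c) = 3` IF AND ONLY IF for all kernel vectors `λ, v` of the polar matrix the polar of
the tangent cubic vanishes, `Σₛ λₛ · degForm 2 (∂ₛ(ser c)) v = 0` (`∂ₛ` = the tree's `MvPowerSeries.pderiv` of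
`Literature.AlgebraicGeometry.Resolution`) — the cubic form of the cleaned state restricted to the kernel
plane is the zero form. Instance `p = 2` PROVED for every `n` by
`CampaignW46.HypersurfacesCharTwo.hypersurface_milnorHilbertTwo_eq_three_iff_polar` (the HilbertThreeIff file, with p530584);
other `p` not claimed. [folklore] -/
def CampaignW46HypersurfacesHilbertThreeIffPolar (p n : ℕ) : Prop :=
  ∀ (κ : Type) [Field κ] [CharP κ p] (c : (Fin n → ℕ) → κ),
    WildCones.MultP p n κ c → CampaignW46.milnorEmbDim p n κ c = 2 →
      (CampaignW46.milnorHilbertTwo p n κ c = 3 ↔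
        ∀ lam v : Fin n → κ,
          Matrix.vecMul lam (Matrix.of fun s t : Fin n => if s = t then (0 : κ)
            else MvPowerSeries.coeff (Finsupp.single s 1 + Finsupp.single t 1) (WildCones.ser p n κ c)) = 0 →
          Matrix.vecMul v (Matrix.of fun s t : Fin n => if s = t then (0 : κ)
            else MvPowerSeries.coeff (Finsupp.single s 1 + Finsupp.single t 1) (WildCones.ser p n κ c)) = 0 →
            ∑ s, lam s * CampaignW46.degForm 2
              (Literature.AlgebraicGeometry.Resolution.MvPowerSeries.pderiv s (WildCones.ser p n κ c)) v = 0)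

/-- [OURS · L1 W4.6 rung (ii), every dimension; near-locus rev 2] replaces the role of NOTHING printed (the positive-dimensional
candidate locus of the «no tangent cubic» class, for OUR dynamics); NOT a statement of the manuscript. For every field `κ` of
characteristic `p` and every ISOLATED `p`-fold state `c` with `e(c) = 2`, `h₂(c) = 3`: every kernel vector `w` of the polar matrix
with a non-zero coordinate `w_i ≠ 0`, read in chart `i` at the translation `w / w_i`, gives a `p`-fold successor, and that successor
is NOT isolated — a whole line `ℙ¹ ⊂ ℙ^{n−1}` of non-isolated infinitely-near `p`-fold points. Instance `p = 2` PROVED for every `n`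
by `CampaignW46.HypersurfacesCharTwo.hypersurface_whole_kernel_near_of_milnorHilbertTwo_eq_three` (p530584); other `p` not claimed.
[folklore] -/
def CampaignW46HypersurfacesHilbertThreeWholeKernel (p n : ℕ) : Prop :=
  ∀ (κ : Type) [Field κ] [CharP κ p] (c : (Fin n → ℕ) → κ) (w : Fin n → κ) (i : Fin n),
    WildCones.MultP p n κ c → WildCones.Isol p n κ c → CampaignW46.milnorEmbDim p n κ c = 2 →
      CampaignW46.milnorHilbertTwo p n κ c = 3 →
      Matrix.vecMul w (Matrix.of fun s t : Fin n => if s = t then (0 : κ)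
        else MvPowerSeries.coeff (Finsupp.single s 1 + Finsupp.single t 1) (WildCones.ser p n κ c)) = 0 →
        w i ≠ 0 →
          WildCones.MultP p n κ (WildCones.step p n κ i ((w i)⁻¹ • w) c) ∧
            ¬ WildCones.Isol p n κ (WildCones.step p n κ i ((w i)⁻¹ • w) c)

/-- [OURS · L1 W4.6 rung (ii), every dimension; near-locus rev 2] replaces the role of NOTHING printed (OUR invariant read off one
value of the tangent cubic); NOT a statement of the manuscript. For every field `κ` of characteristic `p` and every `p`-fold state `c`
with `e(c) = 2`: a kernel vector `v` of the polar matrix with `degForm 3 (ser c) v ≠ 0` forces `h₂(c) ≤ 2`. Instance `p = 2` PROVED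
for every `n` by `CampaignW46.HypersurfacesCharTwo.hypersurface_milnorHilbertTwo_le_two_of_cubic_ne_zero` (p530584); other `p` not
claimed. [folklore] -/
def CampaignW46HypersurfacesCubicOffKernelHilbert (p n : ℕ) : Prop :=
  ∀ (κ : Type) [Field κ] [CharP κ p] (c : (Fin n → ℕ) → κ) (v : Fin n → κ),
    WildCones.MultP p n κ c → CampaignW46.milnorEmbDim p n κ c = 2 →
      Matrix.vecMul v (Matrix.of fun s t : Fin n => if s = t then (0 : κ)
        else MvPowerSeries.coeff (Finsupp.single s 1 + Finsupp.single t 1) (WildCones.ser p n κ c)) = 0 →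
        CampaignW46.degForm 3 (WildCones.ser p n κ c) v ≠ 0 → CampaignW46.milnorHilbertTwo p n κ c ≤ 2

/-- [OURS · L1 W4.6 rung (ii), every dimension; near-locus rev 2] replaces the role of the FINITENESS of the candidate centres after
one blow-up (Th. 16.6 p.84 L4–L6) together with the renewal of isolatedness (§16.3 p.87 L14–L18) for ISOLATED CORANK-TWO
hypersurface `p`-fold points with a kernel vector off the tangent cubic, WITH NUMBERS; NOT a statement of the manuscript. For every
field `κ` of characteristic `p` and every isolated `p`-fold state `c` with `e(c) = 2` and a kernel vector `v` of the polar matrix with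
`degForm 3 (ser c) v ≠ 0`: (1) there is a set `S` of at most THREE vectors of which the near vector of every `p`-fold successor is a
multiple, and (2) every `p`-fold successor is ISOLATED with smaller Milnor number. Instance `p = 2` PROVED for every `n` by
`CampaignW46.HypersurfacesCharTwo.hypersurface_nearPoints_le_three_isolated` (p530584, with p525636 and gen 4's p514670);
other `p` not claimed. [folklore] -/
def CampaignW46HypersurfacesCubicOffKernelIsolated (p n : ℕ) : Prop :=
  ∀ (κ : Type) [Field κ] [CharP κ p] (c : (Fin n → ℕ) → κ) (v : Fin n → κ),
    WildCones.MultP p n κ c → WildCones.Isol p n κ c → CampaignW46.milnorEmbDim p n κ c = 2 →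
      Matrix.vecMul v (Matrix.of fun s t : Fin n => if s = t then (0 : κ)
        else MvPowerSeries.coeff (Finsupp.single s 1 + Finsupp.single t 1) (WildCones.ser p n κ c)) = 0 →
        CampaignW46.degForm 3 (WildCones.ser p n κ c) v ≠ 0 →
          (∃ S : Finset (Fin n → κ), S.card ≤ 3 ∧
            ∀ (i : Fin n) (τ : Fin n → κ), WildCones.MultP p n κ (WildCones.step p n κ i τ c) →
              ∃ w ∈ S, ∃ r : κ, Function.update τ i 1 = r • w) ∧
          ∀ (i : Fin n) (τ : Fin n → κ), WildCones.MultP p n κ (WildCones.step p n κ i τ c) →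
            WildCones.Isol p n κ (WildCones.step p n κ i τ c) ∧
              WildCones.mu p n κ (WildCones.step p n κ i τ c) < WildCones.mu p n κ c


/-- [OURS · L1 W4.6 rung (ii), every dimension; near-locus rev 3] replaces the role of the FREE/SATELLITE distinction among the
infinitely-near points (the bookkeeping of which candidate centres continue the singular chain, Th. 16.6 p.84 L4–L9) for corank-two
hypersurface `p`-fold points, BY THE 3-JET; NOT a statement of the manuscript. For every field `κ` of characteristic `p`, every `p`-fold
state `c` of `z^p = a(u₁,…,uₙ)` with `e(c) = 2`, every chart `i` and translation `τ` whose successor is a `p`-fold point, with near vector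
`w = (τ with i ↦ 1)`: `e(successor) = 2` IFF `Σ_l v_l · degForm 2 (∂_l (ser c)) w = 0` for every kernel vector `v` of the polar matrix
(all polars of the tangent cubic at `w` vanish on the kernel plane). Instance `p = 2` PROVED for every `n` by
`CampaignW46.HypersurfacesCharTwo.hypersurface_milnorEmbDim_step_eq_two_iff` (p533887); other `p` not claimed. [folklore] -/
def CampaignW46HypersurfacesSuccessorCorankTwoIff (p n : ℕ) : Prop :=
  ∀ (κ : Type) [Field κ] [CharP κ p] (c : (Fin n → ℕ) → κ) (i : Fin n) (τ : Fin n → κ),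
    WildCones.MultP p n κ c → CampaignW46.milnorEmbDim p n κ c = 2 → WildCones.MultP p n κ (WildCones.step p n κ i τ c) →
      (CampaignW46.milnorEmbDim p n κ (WildCones.step p n κ i τ c) = 2 ↔
        ∀ v : Fin n → κ,
          Matrix.vecMul v (Matrix.of fun s t : Fin n => if s = t then (0 : κ)
            else MvPowerSeries.coeff (Finsupp.single s 1 + Finsupp.single t 1) (WildCones.ser p n κ c)) = 0 →
            ∑ l, v l * CampaignW46.degForm 2
              (Literature.AlgebraicGeometry.Resolution.MvPowerSeries.pderiv l (WildCones.ser p n κ c)) (Function.update τ i 1) = 0)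

/-- [OURS · L1 W4.6 rung (ii), every dimension; near-locus rev 3] replaces the role of Th. 16.13 p.87 L25–L28 («finitely many times»)
at a FREE near point of a corank-two hypersurface `p`-fold point, WITH THE NUMBER ONE; NOT a statement of the manuscript. For every field
`κ` of characteristic `p`, every `p`-fold state `c` with `e(c) = 2`, every chart `i`, translation `τ` with a `p`-fold successor whose near
vector `w` has a kernel vector `v` of the polar matrix with `Σ_l v_l · degForm 2 (∂_l (ser c)) w ≠ 0` (a simple point of the kernel
cubic): the successor is ISOLATED with Milnor number `1` and NO chart/translation gives a `p`-fold point after it. Instance `p = 2` PROVED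
for every `n` by `CampaignW46.HypersurfacesCharTwo.hypersurface_simple_tangent_resolved` (p533887); other `p` not claimed. [folklore] -/
def CampaignW46HypersurfacesFreePointResolved (p n : ℕ) : Prop :=
  ∀ (κ : Type) [Field κ] [CharP κ p] (c : (Fin n → ℕ) → κ) (i : Fin n) (τ : Fin n → κ) (v : Fin n → κ),
    WildCones.MultP p n κ c → CampaignW46.milnorEmbDim p n κ c = 2 → WildCones.MultP p n κ (WildCones.step p n κ i τ c) →
      Matrix.vecMul v (Matrix.of fun s t : Fin n => if s = t then (0 : κ)
        else MvPowerSeries.coeff (Finsupp.single s 1 + Finsupp.single t 1) (WildCones.ser p n κ c)) = 0 →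
        ∑ l, v l * CampaignW46.degForm 2
          (Literature.AlgebraicGeometry.Resolution.MvPowerSeries.pderiv l (WildCones.ser p n κ c)) (Function.update τ i 1) ≠ 0 →
          WildCones.Isol p n κ (WildCones.step p n κ i τ c) ∧ WildCones.mu p n κ (WildCones.step p n κ i τ c) = 1 ∧
            ∀ (i' : Fin n) (τ' : Fin n → κ),
              ¬ WildCones.MultP p n κ (WildCones.step p n κ i' τ' (WildCones.step p n κ i τ c))

/-- [OURS · L1 W4.6 rung (ii), every dimension; near-locus rev 3] replaces the role of the EXISTENCE of the next centre of the singular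
chain (Th. 16.6 p.84 L4–L6) at a SATELLITE direction of a corank-two hypersurface `p`-fold point; NOT a statement of the manuscript. For
every field `κ` of characteristic `p`, every isolated `p`-fold state `c` with `e(c) = 2`, and every kernel vector `λ` of the polar matrix
with a non-zero coordinate `λ_i` at which all kernel polars of the tangent cubic vanish (`Σ_l v_l · degForm 2 (∂_l (ser c)) λ = 0` for
every kernel `v`): chart `i` at the translation `λ / λ_i` gives a `p`-fold successor, and its corank is again `2`. Instance `p = 2` PROVED
for every `n` by `CampaignW46.HypersurfacesCharTwo.hypersurface_singular_direction_corank_two` (p533887); other `p` not claimed.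
[folklore] -/
def CampaignW46HypersurfacesSatelliteNear (p n : ℕ) : Prop :=
  ∀ (κ : Type) [Field κ] [CharP κ p] (c : (Fin n → ℕ) → κ) (lam : Fin n → κ) (i : Fin n),
    WildCones.MultP p n κ c → WildCones.Isol p n κ c → CampaignW46.milnorEmbDim p n κ c = 2 → lam i ≠ 0 →
      Matrix.vecMul lam (Matrix.of fun s t : Fin n => if s = t then (0 : κ)
        else MvPowerSeries.coeff (Finsupp.single s 1 + Finsupp.single t 1) (WildCones.ser p n κ c)) = 0 →
        (∀ v : Fin n → κ,
          Matrix.vecMul v (Matrix.of fun s t : Fin n => if s = t then (0 : κ)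
            else MvPowerSeries.coeff (Finsupp.single s 1 + Finsupp.single t 1) (WildCones.ser p n κ c)) = 0 →
            ∑ l, v l * CampaignW46.degForm 2
              (Literature.AlgebraicGeometry.Resolution.MvPowerSeries.pderiv l (WildCones.ser p n κ c)) lam = 0) →
          WildCones.MultP p n κ (WildCones.step p n κ i ((lam i)⁻¹ • lam) c) ∧
            CampaignW46.milnorEmbDim p n κ (WildCones.step p n κ i ((lam i)⁻¹ • lam) c) = 2


/-- [OURS · L1 W4.6 rung (ii), every dimension; near-locus rev 4] replaces the role of the DETERMINACY of the continuation of the singular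
chain (Th. 16.6 p.84 L4–L6) for corank-two hypersurface `p`-fold points with `h₂ ≤ 2`; NOT a statement of the manuscript. For every field `κ` of
characteristic `p`, every `p`-fold state `c` of `z^p = a(u₁,…,uₙ)` with `e(c) = 2` and `h₂(c) ≤ 2`, and kernel vectors `w₁ ≠ 0`, `w₂` of the polar
matrix at which all kernel polars of the tangent cubic vanish (singular / satellite directions): `w₂` is a multiple of `w₁` — AT MOST ONE
satellite near point. Instance `p = 2` PROVED for every `n` by `CampaignW46.HypersurfacesCharTwo.hypersurface_satellite_unique` (p536239); other
`p` not claimed. [folklore] -/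
def CampaignW46HypersurfacesSatelliteUnique (p n : ℕ) : Prop :=
  ∀ (κ : Type) [Field κ] [CharP κ p] (c : (Fin n → ℕ) → κ) (w₁ w₂ : Fin n → κ),
    WildCones.MultP p n κ c → CampaignW46.milnorEmbDim p n κ c = 2 → CampaignW46.milnorHilbertTwo p n κ c ≤ 2 → w₁ ≠ 0 →
      Matrix.vecMul w₁ (Matrix.of fun s t : Fin n => if s = t then (0 : κ)
        else MvPowerSeries.coeff (Finsupp.single s 1 + Finsupp.single t 1) (WildCones.ser p n κ c)) = 0 →
      Matrix.vecMul w₂ (Matrix.of fun s t : Fin n => if s = t then (0 : κ)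
        else MvPowerSeries.coeff (Finsupp.single s 1 + Finsupp.single t 1) (WildCones.ser p n κ c)) = 0 →
        (∀ v : Fin n → κ,
          Matrix.vecMul v (Matrix.of fun s t : Fin n => if s = t then (0 : κ)
            else MvPowerSeries.coeff (Finsupp.single s 1 + Finsupp.single t 1) (WildCones.ser p n κ c)) = 0 →
            ∑ l, v l * CampaignW46.degForm 2
              (Literature.AlgebraicGeometry.Resolution.MvPowerSeries.pderiv l (WildCones.ser p n κ c)) w₁ = 0) →
        (∀ v : Fin n → κ,
          Matrix.vecMul v (Matrix.of fun s t : Fin n => if s = t then (0 : κ)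
            else MvPowerSeries.coeff (Finsupp.single s 1 + Finsupp.single t 1) (WildCones.ser p n κ c)) = 0 →
            ∑ l, v l * CampaignW46.degForm 2
              (Literature.AlgebraicGeometry.Resolution.MvPowerSeries.pderiv l (WildCones.ser p n κ c)) w₂ = 0) →
          ∃ r : κ, w₂ = r • w₁

/-- [OURS · L1 W4.6 rung (ii), every dimension; near-locus rev 4] replaces the role of NOTHING printed (the three-tangents class of OUR
invariants has only free near points); NOT a statement of the manuscript. For every field `κ` of characteristic `p`, every isolated `p`-fold
state `c` with `e(c) = 2`, `h₂(c) = 1`, and every kernel vector `λ` of the polar matrix at which all kernel polars of the tangent cubic vanish: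
`λ = 0`. Instance `p = 2` PROVED for every `n` by `CampaignW46.HypersurfacesCharTwo.hypersurface_no_satellite_of_milnorHilbertTwo_eq_one`
(p536239, with gen 4's three-tangents theorem); other `p` not claimed. [folklore] -/
def CampaignW46HypersurfacesNoSatelliteHilbertOne (p n : ℕ) : Prop :=
  ∀ (κ : Type) [Field κ] [CharP κ p] (c : (Fin n → ℕ) → κ) (lam : Fin n → κ),
    WildCones.MultP p n κ c → WildCones.Isol p n κ c → CampaignW46.milnorEmbDim p n κ c = 2 →
      CampaignW46.milnorHilbertTwo p n κ c = 1 →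
      Matrix.vecMul lam (Matrix.of fun s t : Fin n => if s = t then (0 : κ)
        else MvPowerSeries.coeff (Finsupp.single s 1 + Finsupp.single t 1) (WildCones.ser p n κ c)) = 0 →
        (∀ v : Fin n → κ,
          Matrix.vecMul v (Matrix.of fun s t : Fin n => if s = t then (0 : κ)
            else MvPowerSeries.coeff (Finsupp.single s 1 + Finsupp.single t 1) (WildCones.ser p n κ c)) = 0 →
            ∑ l, v l * CampaignW46.degForm 2
              (Literature.AlgebraicGeometry.Resolution.MvPowerSeries.pderiv l (WildCones.ser p n κ c)) lam = 0) →
          lam = 0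

/-- [OURS · L1 W4.6 rung (ii), every dimension, PERFECT field; near-locus rev 4] replaces the role of the EXISTENCE of the continuation of
the singular chain (Th. 16.6 p.84 L4–L6) in the multiple-tangent class of corank-two hypersurface `p`-fold points; NOT a statement of the
manuscript. For every PERFECT field `κ` of characteristic `p` and every `p`-fold state `c` of `z^p = a(u₁,…,uₙ)` with `e(c) = 2`, `h₂(c) = 2`:
there is a NON-ZERO kernel vector `w₀` of the polar matrix at which all kernel polars of the tangent cubic vanish (a satellite direction; by
rev 4's `…SatelliteUnique` the only one). Instance `p = 2` PROVED for every `n` by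
`CampaignW46.HypersurfacesCharTwo.hypersurface_exists_satellite_of_milnorHilbertTwo_eq_two` (SatelliteExists file); other `p` not claimed.
[folklore] -/
def CampaignW46HypersurfacesSatelliteExistsHilbertTwo (p n : ℕ) : Prop :=
  ∀ (κ : Type) [Field κ] [CharP κ p] [PerfectField κ] (c : (Fin n → ℕ) → κ),
    WildCones.MultP p n κ c → CampaignW46.milnorEmbDim p n κ c = 2 → CampaignW46.milnorHilbertTwo p n κ c = 2 →
      ∃ w₀ : Fin n → κ, w₀ ≠ 0 ∧
        Matrix.vecMul w₀ (Matrix.of fun s t : Fin n => if s = t then (0 : κ)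
          else MvPowerSeries.coeff (Finsupp.single s 1 + Finsupp.single t 1) (WildCones.ser p n κ c)) = 0 ∧
        ∀ v : Fin n → κ,
          Matrix.vecMul v (Matrix.of fun s t : Fin n => if s = t then (0 : κ)
            else MvPowerSeries.coeff (Finsupp.single s 1 + Finsupp.single t 1) (WildCones.ser p n κ c)) = 0 →
            ∑ l, v l * CampaignW46.degForm 2
              (Literature.AlgebraicGeometry.Resolution.MvPowerSeries.pderiv l (WildCones.ser p n κ c)) w₀ = 0

/-- [OURS · L1 W4.6 rung (ii), every dimension, PERFECT field; near-locus rev 4] replaces the role of Th. 16.6 p.84 L4–L9 («the next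
centre») together with the renewal of isolatedness (§16.3 p.87 L14–L18) in the multiple-tangent class, WITH NUMBERS; NOT a statement of the
manuscript. For every perfect field `κ` of characteristic `p` and every ISOLATED `p`-fold state `c` with `e(c) = 2`, `h₂(c) = 2`: some chart
`i` and translation `τ` give a `p`-fold successor which has corank `e = 2` again, is ISOLATED, and has smaller Milnor number — the corank-two
chain CONTINUES, at exactly one point. Instance `p = 2` PROVED for every `n` by
`CampaignW46.HypersurfacesCharTwo.hypersurface_satellite_step_of_milnorHilbertTwo_eq_two` (SatelliteExists file, with p533887 and gen 4's
p514670); other `p` not claimed. [folklore] -/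
def CampaignW46HypersurfacesSatelliteStepHilbertTwo (p n : ℕ) : Prop :=
  ∀ (κ : Type) [Field κ] [CharP κ p] [PerfectField κ] (c : (Fin n → ℕ) → κ),
    WildCones.MultP p n κ c → WildCones.Isol p n κ c → CampaignW46.milnorEmbDim p n κ c = 2 →
      CampaignW46.milnorHilbertTwo p n κ c = 2 →
      ∃ (i : Fin n) (τ : Fin n → κ), WildCones.MultP p n κ (WildCones.step p n κ i τ c) ∧
        CampaignW46.milnorEmbDim p n κ (WildCones.step p n κ i τ c) = 2 ∧
        WildCones.Isol p n κ (WildCones.step p n κ i τ c) ∧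
        WildCones.mu p n κ (WildCones.step p n κ i τ c) < WildCones.mu p n κ c


/-- [OURS · L1 W4.6 rung (ii), every dimension; near-locus rev 5] replaces the role of the DESCRIPTION of the next centre (Th. 16.6 p.84
L4–L6) for ISOLATED hypersurface `p`-fold points WITHOUT hyperbolic pair (cleaned order `≥ p + 1`, `¬OrdP`); NOT a statement of the
manuscript. For every field `κ` of characteristic `p`, every isolated `p`-fold state `c` of `z^p = a(u₁,…,uₙ)` with `¬OrdP c`, chart `i`,
translation `τ`: the successor is a `p`-fold point IFF `degForm 3 (ser c) (τ with i ↦ 1) = 0` — the near `p`-fold points are the zeros of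
the tangent cubic in the whole exceptional `ℙ^{n−1}` (for a threefold, a plane cubic curve). Instance `p = 2` PROVED for every `n` by
`CampaignW46.HypersurfacesCharTwo.hypersurface_multP_step_iff_cubic_of_not_ordP` (PairFreeCubic file); other `p` not claimed.
[folklore] -/
def CampaignW46HypersurfacesPairFreeNearCubic (p n : ℕ) : Prop :=
  ∀ (κ : Type) [Field κ] [CharP κ p] (c : (Fin n → ℕ) → κ) (i : Fin n) (τ : Fin n → κ),
    WildCones.MultP p n κ c → WildCones.Isol p n κ c → ¬ WildCones.OrdP p n κ c →
      (WildCones.MultP p n κ (WildCones.step p n κ i τ c) ↔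
        CampaignW46.degForm 3 (WildCones.ser p n κ c) (Function.update τ i 1) = 0)

/-- [OURS · L1 W4.6 rung (ii), THREEFOLDS; near-locus rev 5] replaces the role of Th. 16.6 p.84 L4–L9 (the next centre and its type) for
ISOLATED `p`-fold points of threefold hypersurfaces `z^p = a(u₀,u₁,u₂)`, BY THE 3-JET; NOT a statement of the manuscript. For every field `κ`
of characteristic `p` and every isolated `p`-fold state `c` in `3` variables: EITHER `c` is order-`p`-cleaned with `e(c) = 1` (the
hyperbolic-splitting regime of desk #64 / #126), OR it has no cleaned degree-`p` monomial and then, for every chart and translation, the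
successor is a `p`-fold point iff the tangent cubic vanishes at the near vector, and such a successor is NEVER isolated. Instance `p = 2`
PROVED by `CampaignW46.HypersurfacesCharTwo.threefold_near_dichotomy` (PairFreeCubic file); other `p` not claimed. [folklore] -/
def CampaignW46ThreefoldsNearDichotomy (p : ℕ) : Prop :=
  ∀ (κ : Type) [Field κ] [CharP κ p] (c : (Fin 3 → ℕ) → κ),
    WildCones.MultP p 3 κ c → WildCones.Isol p 3 κ c →
      (WildCones.OrdP p 3 κ c ∧ CampaignW46.milnorEmbDim p 3 κ c = 1) ∨
        (¬ WildCones.OrdP p 3 κ c ∧ ∀ (i : Fin 3) (τ : Fin 3 → κ),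
          (WildCones.MultP p 3 κ (WildCones.step p 3 κ i τ c) ↔
              CampaignW46.degForm 3 (WildCones.ser p 3 κ c) (Function.update τ i 1) = 0) ∧
            (WildCones.MultP p 3 κ (WildCones.step p 3 κ i τ c) → ¬ WildCones.Isol p 3 κ (WildCones.step p 3 κ i τ c)))

end Summit.ResolutionOfSingularities.ResolutionOfSingularities.Theorems

end
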